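import Summits.FinalStateConjecture.FinalStateConjecture.Theorems.SwallowTheDatumParametricKerrBurialLine

/-!
# Line `receding-annulus-universal-collar` — skeleton v2 (lead reshape) for the crux
# `SwallowTheDatum.ParametricKerrBurial` (item stmt-FinalStateConjecture-10052)

Lead prover `prover-line-stmt-FinalStateConjecture-10052-0`, 2026-08-16.  v1 = the planner's checked skeleton
(crux-plan round 1, triaged ×3: stubs `stub_farGluing`, `stub_collarDatum`, `stub_splice`, junction proved).
v2 changes: (i) the vocabulary, the junction lemma and the sorry-free composition `ParametricKerrBurial_of`
now live in the TREE (`Theorems/SwallowTheDatumParametricKerrBurialLine.lean`), so the registered stubs below and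
their landed `--supports` files speak about the SAME declarations; (ii) the planner's transfer engine `stub_splice`
(dilate – transport – patch – breathe, size L but the Lean-heaviest construction) is split into three registered
stubs with explicit signatures — `stub_collarDilation` (dilation covariance of the universal collar on `E3`,
d-free), `stub_transportPatch` (transport the dilated collar into `X` along the end chart and patch it to the
far-glued family along the common exact Schwarzschild(`m R`) annulus; admissibility and shieldedness of the patched
family), `stub_breathing` (pull back by a breathing family of compactly supported diffeomorphisms; comparison family
`E t = Φ_t^* d` and the injectivity marker) — whose conjunction gives `stub_splice` by first-order logic (see
`ParametricKerrBurial_of`).  Stubs A (`stub_farGluing`) and B (`stub_collarDatum`, HARDEST, held by the lead) are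
the planner's, verbatim.  `ParametricKerrBurial_of_stubs` concludes the crux BY NAME from the five stubs.

Disproof used (`Cruxes/ParametricKerrBurial/Disproof.lean`, re-read 2026-08-16T01:40Z, no `-- Targets` section
yet): §2 admissibility of `d` is load-bearing — consumed by `stub_farGluing` and by `F 0 = d`; §3 the crux implies a
shielded admissible datum on `ℝ³` — supplied by `stub_collarDatum` (necessary in substance); §4 `bentHeight_scale`,
`rPlus_scale`, `rMinus_scale` — the dilation covariance `stub_collarDilation` needs exactly these; §5 zero-spin teeth
— respected (`IsKerrShieldedAway 2`: the time-symmetric annulus avoids the shield).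
-/

set_option linter.dupNamespace false

noncomputable section

namespace Summit.FinalStateConjecture.FinalStateConjecture.Cruxes.ParametricKerrBurial.RecedingAnnulusUniversalCollar

open scoped Manifold ContDiff Topology
open Bundle Set Filter Function Literature.Geometry.Lorentzian
open Summit.FinalStateConjecture.FinalStateConjecture.Theorems.SwallowTheDatum.ParametricKerrBurial

/-! ## The registered stubs (`sorry` lives only in these five theorems) -/

/-- **STUB A — `stub_farGluing`** (XL; the `d`-side): receding obstruction-free annular gluing of the admissible
datum `d` onto a GROWING exact isotropic Schwarzschild seed (`m R ≥ η R`), at every radius `R > R⋆`, jointly smooth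
in `(R, x)`; `G R = d` off `e.far R`; exact Schwarzschild(`m R`), `k = 0`, beyond chart radius `32 R`.
Mao–Oh–Tao arXiv:2308.13031 Thm 1.7 at unit scale after rescaling by `R` (proof of Thm 1.10), Def 1.5
(`s = 2`, `α = 1` = the DR class), Rem 1.9/1.11; the `C^∞`-in-`R` dependence is the unprinted atom. -/
theorem stub_farGluing : ∀ (X : Type) [TopologicalSpace X] [ChartedSpace E3 X] [IsManifold (𝓡 3) ∞ X] [T2Space X]
      [SecondCountableTopology X] [ConnectedSpace X], ∀ d ∈ admissibleVacuumData X,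
      ∃ (η : ℝ) (e : AFEnd X) (Rstar : ℝ) (m : ℝ → ℝ) (G : ℝ → InitialDataSet (𝓡 3) X),
        0 < η ∧ e.IsSoleEnd ∧ e.R < Rstar ∧ ContDiff ℝ ∞ m ∧ SmoothSectionsOn 𝓘(ℝ, ℝ) G {p : ℝ × X | Rstar < p.1} ∧
        ∀ R : ℝ, Rstar < R → G R ∈ admissibleVacuumData X ∧ (∀ x ∉ e.far R, AgreeAt (G R) d x) ∧
          η * R ≤ m R ∧ IsExactSchwarzschildBeyond e (G R) (m R) (32 * R) := by
  sorry

/-- **STUB B — `stub_collarDatum`** (XL; HARDEST; d-free; held by the lead): ONE universal collar datum on `ℝ³` —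
admissible, exact isotropic Schwarzschild(`μ`) on `{1 < ‖y‖ < 2}`, Kerr-shielded beyond radius `2` (engines: E-a
elliptic re-gluing of Li–Mei's datum, E-b Hintz-once + MOT interior step, E-c null-shell shadow).  Strictly implies
the sibling crux `KerrShieldedDataExist` (stmt-FinalStateConjecture-10055). -/
theorem stub_collarDatum : ∀ [Kerr.Facts], ∀ μ₀ : ℝ, 0 < μ₀ → ∃ μ : ℝ, 0 < μ ∧ μ ≤ μ₀ ∧
      ∃ C ∈ admissibleVacuumData E3, IsSchwarzschildAnnulus C μ ∧ IsKerrShieldedAway 2 C := by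
  sorry

/-- **STUB C1 — `stub_collarDilation`** (M/L; d-free; elementary): DILATION COVARIANCE of the universal collar.
`Cfam l := Δ_l^* C` rescaled (`h ↦ l² Δ^*h`, `k ↦ l Δ^*k`, `Δ y = y/l`; chart components `h_C(y/l)`,
`l⁻¹ k_C(y/l)`): admissible (constraints scale by `l⁻²`/`l⁻¹`, completeness and the DR end dilate), exact
Schwarzschild(`lμ`) on `{l < ‖y‖ < 2l}`, shielded beyond `2l` by Kerr(`lM, la`) with junction `l r₁`
(`g_{lM,la}(lx) = g_{M,a}(x)` componentwise, `r_{la}(lx) = l r_a(x)`, `T_{lM,la}(lr) = l T_{M,a}(r)`,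
`K ↦ l K`), and jointly smooth in `(l, y)` on `{0 < l}`. -/
theorem stub_collarDilation : ∀ [Kerr.Facts] (C : InitialDataSet (𝓡 3) E3) (μ : ℝ), 0 < μ → C ∈ admissibleVacuumData E3 →
      IsSchwarzschildAnnulus C μ → IsKerrShieldedAway 2 C → ∃ Cfam : ℝ → InitialDataSet (𝓡 3) E3,
        SmoothSectionsOn 𝓘(ℝ, ℝ) Cfam {p : ℝ × E3 | 0 < p.1} ∧ ∀ l : ℝ, 0 < l → Cfam l ∈ admissibleVacuumData E3 ∧
          (∀ y : E3, l < ‖y‖ → ‖y‖ < 2 * l → (Cfam l).h.inner y =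
              (1 + l * μ / (2 * ‖y‖)) ^ 4 • (innerSL ℝ : E3 →L[ℝ] E3 →L[ℝ] ℝ) ∧ (Cfam l).k y = 0) ∧
          IsKerrShieldedAway (2 * l) (Cfam l) := by
  sorry

/-- **STUB C2 — `stub_transportPatch`** (L; the patching engine on the abstract `X`): with `λ(R) := m R / μ ≥ 32 R`
put the transported collar `e.dataChart_* (Cfam (λ R))` on `e.far (3λ/2)` and `G R` elsewhere — the two agree on the
open overlap `dataChart {λ < ‖x‖ < 2λ}` (both exact isotropic Schwarzschild(`m R`), `k = 0`), so `P R` is a smooth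
datum; admissible (constraints are local; completeness by the sole-end escape argument; the end = `dataChart` ∘ the
collar's own DR chart pushed beyond the ball, sole because `e` is sole); Kerr-shielded by `dataChart ∘ φ_{Cfam}`
(shield range `⊆ {2λ < ‖y‖}`); `P R = G R` off `e.far (32 R)`; jointly smooth in `(R, x)` on `{R⋆ < R}`. -/
theorem stub_transportPatch : ∀ [Kerr.Facts] (X : Type) [TopologicalSpace X] [ChartedSpace E3 X] [IsManifold (𝓡 3) ∞ X]
      [T2Space X] [SecondCountableTopology X] [ConnectedSpace X] (e : AFEnd X) (Rstar η μ : ℝ) (m : ℝ → ℝ)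
      (G : ℝ → InitialDataSet (𝓡 3) X) (Cfam : ℝ → InitialDataSet (𝓡 3) E3), e.IsSoleEnd → e.R < Rstar → 0 < μ →
      32 * μ ≤ η → ContDiff ℝ ∞ m → SmoothSectionsOn 𝓘(ℝ, ℝ) G {p : ℝ × X | Rstar < p.1} →
      (∀ R : ℝ, Rstar < R → G R ∈ admissibleVacuumData X ∧ η * R ≤ m R ∧
        IsExactSchwarzschildBeyond e (G R) (m R) (32 * R)) →
      SmoothSectionsOn 𝓘(ℝ, ℝ) Cfam {p : ℝ × E3 | 0 < p.1} →
      (∀ l : ℝ, 0 < l → Cfam l ∈ admissibleVacuumData E3 ∧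
        (∀ y : E3, l < ‖y‖ → ‖y‖ < 2 * l → (Cfam l).h.inner y =
            (1 + l * μ / (2 * ‖y‖)) ^ 4 • (innerSL ℝ : E3 →L[ℝ] E3 →L[ℝ] ℝ) ∧ (Cfam l).k y = 0) ∧
        IsKerrShieldedAway (2 * l) (Cfam l)) →
      ∃ P : ℝ → InitialDataSet (𝓡 3) X, SmoothSectionsOn 𝓘(ℝ, ℝ) P {p : ℝ × X | Rstar < p.1} ∧
        ∀ R : ℝ, Rstar < R → P R ∈ admissibleVacuumData X ∧ IsKerrShielded X (P R) ∧
          ∀ x ∉ e.far (32 * R), AgreeAt (P R) (G R) x := by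
  sorry

/-- **STUB C3 — `stub_breathing`** (M/L; pure differential topology on `X` + diffeomorphism invariance of
admissibility and shieldedness): choose a chart ball `B = dataChart (ball p₀ ρ) ⊂ {e.R < ‖·‖ < R⋆}` and the
compactly supported breathing diffeomorphisms `Φ_t = dataChart ∘ (x ↦ p₀ + (1 + σ(t) β(‖x − p₀‖)) (x − p₀)) ∘ chart`
(`= id` off `B`, `σ` a small smooth injective squashing with `σ 0 = 0`, `β` a bump `= 1` near `0`); put
`E t := Φ_t^* d`, `S (R, t) := Φ_t^* (P R)` (`InitialDataSet.comap`): `E 0 = d` (`comap_eq_self_of_eq_id`),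
`S (R, t) = E t` off `e.far R` (`P R = d` there, `Φ_t(B) = B`, `B ∩ e.far R = ∅`), marker
`h_{E t}(x₀)(v₀, v₀) = (1 + σ t)² h_d(x₀)(v₀, v₀)` at `x₀ = dataChart p₀` injective, admissibility and
`IsKerrShielded` invariant under pull-back by a diffeomorphism, joint smoothness by composition. -/
theorem stub_breathing : ∀ [Kerr.Facts] (X : Type) [TopologicalSpace X] [ChartedSpace E3 X] [IsManifold (𝓡 3) ∞ X]
      [T2Space X] [SecondCountableTopology X] [ConnectedSpace X] (d : InitialDataSet (𝓡 3) X) (e : AFEnd X)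
      (Rstar : ℝ) (P : ℝ → InitialDataSet (𝓡 3) X), e.R < Rstar →
      SmoothSectionsOn 𝓘(ℝ, ℝ) P {p : ℝ × X | Rstar < p.1} →
      (∀ R : ℝ, Rstar < R → P R ∈ admissibleVacuumData X ∧ IsKerrShielded X (P R) ∧
        ∀ x ∉ e.far R, AgreeAt (P R) d x) →
      ∃ (S : ℝ × ℝ → InitialDataSet (𝓡 3) X) (E : ℝ → InitialDataSet (𝓡 3) X) (x₀ : X)
        (v₀ : TangentSpace (𝓡 3) x₀),
        SmoothSectionsOn (𝓘(ℝ, ℝ).prod 𝓘(ℝ, ℝ)) S {p : (ℝ × ℝ) × X | Rstar < p.1.1} ∧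
        SmoothSectionsOn 𝓘(ℝ, ℝ) E (Set.univ : Set (ℝ × X)) ∧ E 0 = d ∧
        (∀ R t : ℝ, Rstar < R → ∀ x ∉ e.far R, AgreeAt (S (R, t)) (E t) x) ∧ x₀ ∉ e.far Rstar ∧
        Set.InjOn (fun t : ℝ ↦ (E t).h.inner x₀ v₀ v₀) (Set.Ioo (-1) 1) ∧
        ∀ R t : ℝ, Rstar < R → |t| < 1 → S (R, t) ∈ admissibleVacuumData X ∧ IsKerrShielded X (S (R, t)) := by
  sorry

/-! ## Kernel-checked composition: the five stubs prove the crux BY NAME -/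

/-- **The line closes the crux**, fed with the registered stubs (so the audit sees the crux decl inhabited modulo
the five `sorry`s and nothing else); the glue `ParametricKerrBurial_of` is the tree's
(`Theorems/SwallowTheDatumParametricKerrBurialLine.lean`). -/
theorem ParametricKerrBurial_of_stubs :
    Summit.FinalStateConjecture.FinalStateConjecture.Theses.SwallowTheDatum.ParametricKerrBurial :=
  ParametricKerrBurial_of stub_farGluing stub_collarDatum stub_collarDilation stub_transportPatch stub_breathing

end Summit.FinalStateConjecture.FinalStateConjecture.Cruxes.ParametricKerrBurial.RecedingAnnulusUniversalCollar

end
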